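import Mathlib
import Summits.ABC.ABC.Statement

/-!
# Stub `stub_quarticThueWindow` of line `Sketch` — crux `IneffectiveSubspace.DepthCountedABC` (stmt-ABC-14938)

THE WINDOW OF THE CELL-0 SUB-CRUX (lead c22).  By lead c19 the first improvement of the free exponent `2` on the 5-free cell
is equivalent to uniform binomial quartic Thue `UniformQuarticThue η` (bounded `Z` for the positive coprime solutions of
`a + u·Y⁴ = v·Z⁴` with `a·u·v ≤ Z^η`).  This certificate pins the admissible `η`:
* `quarticThue_of_abc`: `ABC ⟹ UniformQuarticThue η` for `0 < η < 8/5` — `(a, uY⁴, vZ⁴)` is an abc triple with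
  `rad ≤ a·u·v·Y·Z ≤ Z^(2+5η/4)` and `c ≥ Z⁴`.
* `not_quarticThue_of_two_lt`: FALSE for every `η > 2` — good approximations `p/d` of the irrational `2^(1/4)` (Dirichlet,
  `d → ∞`) give `|p⁴ − 2d⁴| ≤ 65d²`, `p > d`, and the parity-arranged configurations `(p⁴−2d⁴) + 2d⁴ = p⁴`,
  `(2d⁴−p⁴) + p⁴ = 2d⁴` (`p` odd), `(8p'⁴−d⁴) + d⁴ = 8p'⁴`, `(d⁴−8p'⁴) + 8p'⁴ = d⁴` (`p = 2p'`, `d` odd) are positive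
  coprime solutions with `a·u·v ≤ 260d² ≤ 1040Z² ≤ Z^η` and `Z ≥ d/2` unbounded.
Heuristically the threshold is exactly `2` (`Σ_{u,v} u^(−5/4)v^(−7/4) < ∞`), so only `(8/5, 2]` is undecided.
Sources: skeleton `Cruxes/DepthCountedABC/Lines/Sketch.lean` (c22, Stub 18); Mathlib only.
-/

-- `Summit.<Summit>.<Problem>` is the mandated summit-side namespace (CONVENTIONS §2); for the
-- single-conjunct summit `ABC` the two coincide, so the duplicate `ABC.ABC` is deliberate.
set_option linter.dupNamespace false

namespace Summit.ABC.ABC.Theorems.DepthCountedABC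

open UniqueFactorizationMonoid (radical)
open Literature.NumberTheory.DiophantineGeometry (IsABCTriple rad rad_def)

/-- `rad(u·Y⁴) ≤ u·Y` for positive `u, Y`. [folklore] -/
theorem radical_mul_pow_four_le {u Y : ℕ} (hu : 0 < u) (hY : 0 < Y) : radical (u * Y ^ 4) ≤ u * Y := by
  have h1 : radical (u * Y ^ 4) ∣ radical u * radical (Y ^ 4) := UniqueFactorizationMonoid.radical_mul_dvd
  rw [UniqueFactorizationMonoid.radical_pow Y (by norm_num : (4 : ℕ) ≠ 0)] at h1
  calc radical (u * Y ^ 4) ≤ radical u * radical Y := Nat.le_of_dvd (by positivity) h1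
    _ ≤ u * Y := Nat.mul_le_mul (Nat.radical_le_self_iff.mpr hu.ne') (Nat.radical_le_self_iff.mpr hY.ne')

/-- For a positive coprime solution of `a + u·Y⁴ = v·Z⁴`: `(a, uY⁴, vZ⁴)` is an abc triple with
`rad ≤ a·u·v·Y·Z`. [folklore] -/
theorem quarticThue_triple {a u v Y Z : ℕ} (ha : 0 < a) (hu : 0 < u) (hv : 0 < v) (hY : 0 < Y) (hZ : 0 < Z)
    (hsum : a + u * Y ^ 4 = v * Z ^ 4) (hcop : Nat.Coprime (u * Y ^ 4) (v * Z ^ 4)) :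
    IsABCTriple a (u * Y ^ 4) (v * Z ^ 4) ∧ rad a (u * Y ^ 4) (v * Z ^ 4) ≤ a * u * v * Y * Z := by
  set b : ℕ := u * Y ^ 4 with hb
  set c : ℕ := v * Z ^ 4 with hc
  have hab : Nat.Coprime a b := by
    have h1 : Nat.Coprime b (a + b) := by rw [hsum]; exact hcop
    rw [add_comm, Nat.coprime_self_add_right] at h1
    exact h1.symm
  refine ⟨⟨ha, by positivity, hsum, hab⟩, ?_⟩
  have h2 : radical (a * b * c) ≤ radical (a * b) * radical c :=
    Nat.le_of_dvd (by positivity) UniqueFactorizationMonoid.radical_mul_dvd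
  have h3 : radical (a * b) ≤ radical a * radical b :=
    Nat.le_of_dvd (by positivity) UniqueFactorizationMonoid.radical_mul_dvd
  calc rad a b c = radical (a * b * c) := rad_def a b c
    _ ≤ radical a * radical b * radical c := h2.trans (Nat.mul_le_mul_right _ h3)
    _ ≤ a * (u * Y) * (v * Z) := Nat.mul_le_mul (Nat.mul_le_mul (Nat.radical_le_self_iff.mpr ha.ne')
        (radical_mul_pow_four_le hu hY)) (radical_mul_pow_four_le hv hZ)
    _ = a * u * v * Y * Z := by ring

/-- From `(Z : ℝ) < T` to `Z ≤ ⌊T⌋₊`. [folklore] -/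
theorem nat_le_floor_of_lt {Z : ℕ} {T : ℝ} (hT : (Z : ℝ) < T) : Z ≤ ⌊T⌋₊ := by
  have h2 : Z < ⌊T⌋₊ + 1 := by exact_mod_cast hT.trans (Nat.lt_floor_add_one T)
  omega

/-- **Part (i).** `ABC ⟹ UniformQuarticThue η` for every `0 < η < 8/5`. [folklore reduction] -/
theorem quarticThue_of_abc (habc : _root_.ABC) : ∀ η : ℝ, 0 < η → η < 8 / 5 →
    ∃ B : ℕ, ∀ a u v Y Z : ℕ, 0 < a → 0 < u → 0 < v → 0 < Y → 0 < Z →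
      a + u * Y ^ 4 = v * Z ^ 4 → Nat.Coprime (u * Y ^ 4) (v * Z ^ 4) →
      ((a * u * v : ℕ) : ℝ) ≤ (Z : ℝ) ^ η → Z ≤ B := by
  intro η hη hη85
  set s : ℝ := 2 + 5 * η / 4 with hs
  have hs0 : 0 < s := by rw [hs]; linarith
  have hs4 : s < 4 := by rw [hs]; linarith
  set ε : ℝ := (4 - s) / (2 * s) with hε
  have hεpos : 0 < ε := by rw [hε]; exact div_pos (by linarith) (by linarith)
  set κ : ℝ := (4 - s) / 2 with hκ
  have hκpos : 0 < κ := by rw [hκ]; linarith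
  have hsε : s * (1 + ε) = 4 - κ := by
    rw [hε, hκ]; field_simp; ring
  obtain ⟨C, hCpos, hC⟩ := (ABC_iff.mp habc) ε hεpos
  refine ⟨⌊C ^ (1 / κ)⌋₊, ?_⟩
  intro a u v Y Z ha hu hv hY hZ hsum hcop hauv
  obtain ⟨habc3, hRle⟩ := quarticThue_triple ha hu hv hY hZ hsum hcop
  have hlt := hC a (u * Y ^ 4) (v * Z ^ 4) habc3
  set R : ℕ := rad a (u * Y ^ 4) (v * Z ^ 4) with hR
  have hZ1 : (1 : ℝ) ≤ (Z : ℝ) := by exact_mod_cast hZ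
  have hZ0 : (0 : ℝ) < (Z : ℝ) := by linarith
  have hY0 : (0 : ℝ) ≤ (Y : ℝ) := by positivity
  have hcZ : (Z : ℝ) ^ (4 : ℕ) ≤ ((v * Z ^ 4 : ℕ) : ℝ) := by exact_mod_cast Nat.le_mul_of_pos_left (Z ^ 4) hv
  have hY4nat : Y ^ 4 < (a * u * v) * Z ^ 4 := by
    have h1 : Y ^ 4 ≤ u * Y ^ 4 := Nat.le_mul_of_pos_left _ hu
    have h2 : u * Y ^ 4 < v * Z ^ 4 := by omega
    have h3 : v * Z ^ 4 ≤ (a * u * v) * Z ^ 4 := Nat.mul_le_mul_right _ (Nat.le_mul_of_pos_left v (by positivity))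
    omega
  have hY4 : (Y : ℝ) ^ (4 : ℕ) ≤ (Z : ℝ) ^ (4 + η) := by
    have h1 : ((Y ^ 4 : ℕ) : ℝ) ≤ (((a * u * v) * Z ^ 4 : ℕ) : ℝ) := by exact_mod_cast hY4nat.le
    push_cast at h1
    calc (Y : ℝ) ^ (4 : ℕ) ≤ ((a : ℝ) * u * v) * (Z : ℝ) ^ (4 : ℕ) := h1
      _ ≤ (Z : ℝ) ^ η * (Z : ℝ) ^ (4 : ℕ) := by
          apply mul_le_mul_of_nonneg_right _ (by positivity)
          exact_mod_cast hauv
      _ = (Z : ℝ) ^ (4 + η) := by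
          rw [Real.rpow_add hZ0, ← Real.rpow_natCast (Z : ℝ) 4]; push_cast; ring
  have hYle : (Y : ℝ) ≤ (Z : ℝ) ^ (1 + η / 4) := by
    have h1 : ((Y : ℝ) ^ (4 : ℕ)) ^ ((1 : ℝ) / 4) ≤ ((Z : ℝ) ^ (4 + η)) ^ ((1 : ℝ) / 4) :=
      Real.rpow_le_rpow (by positivity) hY4 (by norm_num)
    have h2 : ((Y : ℝ) ^ (4 : ℕ)) ^ ((1 : ℝ) / 4) = (Y : ℝ) := by
      rw [← Real.rpow_natCast, ← Real.rpow_mul hY0]; norm_num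
    have h3 : ((Z : ℝ) ^ (4 + η)) ^ ((1 : ℝ) / 4) = (Z : ℝ) ^ (1 + η / 4) := by
      rw [← Real.rpow_mul hZ0.le]; congr 1; ring
    rw [h2, h3] at h1; exact h1
  have hRreal : (R : ℝ) ≤ (Z : ℝ) ^ s := by
    have h1 : (R : ℝ) ≤ ((a : ℝ) * u * v) * Y * Z := by exact_mod_cast hRle
    have hauv' : (a : ℝ) * u * v ≤ (Z : ℝ) ^ η := by exact_mod_cast hauv
    have h2 : ((a : ℝ) * u * v) * Y * Z ≤ (Z : ℝ) ^ η * (Z : ℝ) ^ (1 + η / 4) * (Z : ℝ) :=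
      mul_le_mul_of_nonneg_right (mul_le_mul hauv' hYle hY0 (by positivity)) hZ0.le
    have h3 : (Z : ℝ) ^ s = (Z : ℝ) ^ η * (Z : ℝ) ^ (1 + η / 4) * (Z : ℝ) := by
      rw [hs, show 2 + 5 * η / 4 = η + (1 + η / 4) + 1 by ring, Real.rpow_add hZ0, Real.rpow_add hZ0, Real.rpow_one]
    linarith [h1, h2, h3.ge]
  have hR0 : (0 : ℝ) ≤ (R : ℝ) := by positivity
  have hRpow : (R : ℝ) ^ (1 + ε) ≤ (Z : ℝ) ^ (4 - κ) :=
    calc (R : ℝ) ^ (1 + ε) ≤ ((Z : ℝ) ^ s) ^ (1 + ε) := Real.rpow_le_rpow hR0 hRreal (by linarith)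
      _ = (Z : ℝ) ^ (s * (1 + ε)) := by rw [← Real.rpow_mul hZ0.le]
      _ = (Z : ℝ) ^ (4 - κ) := by rw [hsε]
  have hZ4lt : (Z : ℝ) ^ (4 : ℕ) < C * (Z : ℝ) ^ (4 - κ) :=
    calc (Z : ℝ) ^ (4 : ℕ) ≤ ((v * Z ^ 4 : ℕ) : ℝ) := hcZ
      _ < C * ((rad a (u * Y ^ 4) (v * Z ^ 4) : ℕ) : ℝ) ^ (1 + ε) := hlt
      _ = C * (R : ℝ) ^ (1 + ε) := by rw [hR]
      _ ≤ C * (Z : ℝ) ^ (4 - κ) := mul_le_mul_of_nonneg_left hRpow hCpos.le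
  have hsplit : (Z : ℝ) ^ (4 : ℕ) = (Z : ℝ) ^ κ * (Z : ℝ) ^ (4 - κ) := by
    rw [← Real.rpow_add hZ0, ← Real.rpow_natCast (Z : ℝ) 4]; congr 1; push_cast; ring
  have hZκ : (Z : ℝ) ^ κ < C := by
    rw [hsplit] at hZ4lt
    exact lt_of_mul_lt_mul_right hZ4lt (Real.rpow_nonneg hZ0.le _)
  have hZlt : (Z : ℝ) < C ^ (1 / κ) := by
    have h1 : ((Z : ℝ) ^ κ) ^ (1 / κ) < C ^ (1 / κ) :=
      Real.rpow_lt_rpow (Real.rpow_nonneg hZ0.le _) hZκ (by positivity)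
    have h2 : ((Z : ℝ) ^ κ) ^ (1 / κ) = (Z : ℝ) := by
      rw [← Real.rpow_mul hZ0.le, mul_one_div_cancel hκpos.ne', Real.rpow_one]
    rw [h2] at h1; exact h1
  exact nat_le_floor_of_lt hZlt

/-- Good rational approximations with arbitrarily large denominator: for irrational `ξ` and every `N` there is `q` with
`|ξ − q| < 1/den(q)²` and `den(q) > N` (the good approximations are infinitely many, those with `den ≤ N` finitely many). [folklore] -/
theorem exists_rat_approx_den_gt {ξ : ℝ} (hξ : Irrational ξ) (N : ℕ) :
    ∃ q : ℚ, |ξ - q| < 1 / (q.den : ℝ) ^ 2 ∧ N < q.den := by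
  by_contra h
  push Not at h
  apply Real.infinite_rat_abs_sub_lt_one_div_den_sq_of_irrational hξ
  set M : ℤ := ⌈(|ξ| + 1) * N⌉ with hM
  have hsub : {q : ℚ | |ξ - q| < 1 / (q.den : ℝ) ^ 2} ⊆
      (fun nd : ℤ × ℕ => ((nd.1 : ℚ) / nd.2)) '' (Set.Icc (-M) M ×ˢ Set.Icc 0 N) := by
    intro q (hq : |ξ - q| < 1 / (q.den : ℝ) ^ 2)
    have hden : q.den ≤ N := h q hq
    have hd1 : (1 : ℝ) ≤ q.den := by exact_mod_cast q.pos
    have hlt1 : |ξ - q| < 1 := by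
      have : 1 / (q.den : ℝ) ^ 2 ≤ 1 := by rw [div_le_one (by positivity)]; nlinarith
      linarith
    have hqabs : |(q : ℝ)| ≤ |ξ| + 1 := by
      have := abs_sub_abs_le_abs_sub (q : ℝ) ξ
      rw [abs_sub_comm] at this
      linarith
    have hnum : (q.num : ℝ) = (q : ℝ) * q.den := by
      have h1 : (q : ℚ) * q.den = q.num := Rat.mul_den_eq_num q
      exact_mod_cast h1.symm
    have hnumabs : |(q.num : ℝ)| ≤ (|ξ| + 1) * N := by
      rw [hnum, abs_mul, Nat.abs_cast]
      exact mul_le_mul hqabs (by exact_mod_cast hden) (by positivity) (by positivity)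
    have hnumM : |(q.num : ℝ)| ≤ (M : ℝ) := hnumabs.trans (by rw [hM]; exact Int.le_ceil _)
    have hnumM' : |q.num| ≤ M := by
      have : ((|q.num| : ℤ) : ℝ) ≤ (M : ℝ) := by push_cast; exact hnumM
      exact_mod_cast this
    exact ⟨(q.num, q.den), ⟨⟨(abs_le.mp hnumM').1, (abs_le.mp hnumM').2⟩, Nat.zero_le _, hden⟩, Rat.num_div_den q⟩
  exact (Set.Finite.image _ ((Set.finite_Icc _ _).prod (Set.finite_Icc _ _))).subset hsub

/-- For `η > 2` there is a threshold `T` with `1040·Z² ≤ Z^η` for all `Z ≥ T`. [folklore] -/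
theorem exists_threshold_two_lt {η : ℝ} (hη : 2 < η) :
    ∃ T : ℕ, ∀ Z : ℕ, T ≤ Z → (1040 : ℝ) * (Z : ℝ) ^ (2 : ℕ) ≤ (Z : ℝ) ^ η := by
  set κ : ℝ := η - 2 with hκ
  have hκpos : 0 < κ := by rw [hκ]; linarith
  refine ⟨⌈(1040 : ℝ) ^ (1 / κ)⌉₊ + 1, ?_⟩
  intro Z hZ
  have hZreal : (1040 : ℝ) ^ (1 / κ) ≤ (Z : ℝ) := by
    have h1 : (1040 : ℝ) ^ (1 / κ) ≤ ⌈(1040 : ℝ) ^ (1 / κ)⌉₊ := Nat.le_ceil _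
    have h2 : ((⌈(1040 : ℝ) ^ (1 / κ)⌉₊ : ℕ) : ℝ) ≤ (Z : ℝ) := by exact_mod_cast (by omega : ⌈(1040 : ℝ) ^ (1 / κ)⌉₊ ≤ Z)
    linarith
  have hZ0 : (0 : ℝ) < (Z : ℝ) := lt_of_lt_of_le (by positivity) hZreal
  have hZκ : (1040 : ℝ) ≤ (Z : ℝ) ^ κ := by
    have h1 : ((1040 : ℝ) ^ (1 / κ)) ^ κ ≤ (Z : ℝ) ^ κ := Real.rpow_le_rpow (by positivity) hZreal hκpos.le
    have h2 : ((1040 : ℝ) ^ (1 / κ)) ^ κ = 1040 := by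
      rw [← Real.rpow_mul (by norm_num), one_div_mul_cancel hκpos.ne', Real.rpow_one]
    rw [h2] at h1; exact h1
  have hsplit : (Z : ℝ) ^ η = (Z : ℝ) ^ κ * (Z : ℝ) ^ (2 : ℕ) := by
    rw [← Real.rpow_natCast (Z : ℝ) 2, ← Real.rpow_add hZ0, hκ]; congr 1; push_cast; ring
  rw [hsplit]
  exact mul_le_mul_of_nonneg_right hZκ (by positivity)

/-- Numerics of a good approximation `p/d` of a real `α` with `α⁴ = 2`, `7/6 < α < 6/5`, `d ≥ 4`:
`d < p < 3d` and `|p⁴ − 2d⁴| ≤ 65·d²`. [folklore] -/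
theorem approx_fourthRootTwo_bounds {α : ℝ} (hα4 : α ^ 4 = 2) (hαlo : 7 / 6 < α) (hαhi : α < 6 / 5)
    {p d : ℕ} (hd : 4 ≤ d) (happ : |α - (p : ℝ) / d| < 1 / (d : ℝ) ^ 2) :
    d < p ∧ p < 3 * d ∧ |(p : ℝ) ^ 4 - 2 * (d : ℝ) ^ 4| ≤ 65 * (d : ℝ) ^ 2 := by
  set x : ℝ := (p : ℝ) with hx
  set y : ℝ := (d : ℝ) with hy
  have hy4 : (4 : ℝ) ≤ y := by rw [hy]; exact_mod_cast hd
  have hy0 : 0 < y := by linarith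
  have hx0 : 0 ≤ x := by rw [hx]; positivity
  have h1 : |α * y - x| < 1 / y := by
    have := happ
    rw [show α - x / y = (α * y - x) / y by field_simp, abs_div, abs_of_pos hy0,
      div_lt_iff₀ hy0] at this
    calc |α * y - x| < 1 / y ^ 2 * y := this
      _ = 1 / y := by field_simp
  have hy_inv : 1 / y ≤ 1 / 4 := one_div_le_one_div_of_le (by norm_num) hy4
  have h2 := abs_lt.mp (lt_of_lt_of_le h1 hy_inv)
  have hdp : y < x := by nlinarith [h2.1, h2.2]
  have hp3 : x < 3 * y := by nlinarith [h2.1, h2.2]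
  have hdp' : d < p := by
    have h := hdp
    rw [hx, hy] at h
    exact_mod_cast h
  have hp3' : p < 3 * d := by
    have h := hp3
    rw [hx, hy] at h
    exact_mod_cast h
  refine ⟨hdp', hp3', ?_⟩
  set S : ℝ := x ^ 3 + x ^ 2 * (α * y) + x * (α * y) ^ 2 + (α * y) ^ 3 with hS
  have hαy0 : 0 ≤ α * y := by positivity
  have hαy2 : α * y ≤ 2 * y := by nlinarith
  have hS0 : 0 ≤ S := by rw [hS]; positivity
  have hS65 : S ≤ 65 * y ^ 3 := by
    rw [hS]
    have hx3 : x ^ 3 ≤ 27 * y ^ 3 := by nlinarith [pow_le_pow_left₀ hx0 hp3.le 3]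
    have hx2 : x ^ 2 * (α * y) ≤ 9 * y ^ 2 * (2 * y) := by
      apply mul_le_mul _ hαy2 hαy0 (by positivity)
      nlinarith [pow_le_pow_left₀ hx0 hp3.le 2]
    have hx1 : x * (α * y) ^ 2 ≤ (3 * y) * (2 * y) ^ 2 := by
      apply mul_le_mul hp3.le (pow_le_pow_left₀ hαy0 hαy2 2) (by positivity) (by positivity)
    have hx00 : (α * y) ^ 3 ≤ (2 * y) ^ 3 := pow_le_pow_left₀ hαy0 hαy2 3
    nlinarith
  have hfac : x ^ 4 - 2 * y ^ 4 = (x - α * y) * S := by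
    have : (α * y) ^ 4 = 2 * y ^ 4 := by rw [mul_pow, hα4]
    rw [← this, hS]; ring
  have he : |x - α * y| ≤ 1 / y := by rw [abs_sub_comm]; exact h1.le
  calc |x ^ 4 - 2 * y ^ 4| = |x - α * y| * |S| := by rw [hfac, abs_mul]
    _ = |x - α * y| * S := by rw [abs_of_nonneg hS0]
    _ ≤ (1 / y) * (65 * y ^ 3) := mul_le_mul he hS65 hS0 (by positivity)
    _ = 65 * y ^ 2 := by field_simp

/-- The generic contradiction step: a positive coprime solution with `a·u·v ≤ 260·D²`, `D ≤ 2Z` and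
`D > 2(B + T)` has `a·u·v ≤ 1040·Z² ≤ Z^η` and `Z > B`, against the uniform bound `B`. [folklore] -/
theorem quarticThue_solution_contra {η : ℝ} {B T : ℕ}
    (hT : ∀ Z : ℕ, T ≤ Z → (1040 : ℝ) * (Z : ℝ) ^ (2 : ℕ) ≤ (Z : ℝ) ^ η)
    (hB : ∀ a u v Y Z : ℕ, 0 < a → 0 < u → 0 < v → 0 < Y → 0 < Z →
      a + u * Y ^ 4 = v * Z ^ 4 → Nat.Coprime (u * Y ^ 4) (v * Z ^ 4) →
      ((a * u * v : ℕ) : ℝ) ≤ (Z : ℝ) ^ η → Z ≤ B)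
    {a u v Y Z D : ℕ} (ha : 0 < a) (hu : 0 < u) (hv : 0 < v) (hY : 0 < Y) (hZ : 0 < Z)
    (hsum : a + u * Y ^ 4 = v * Z ^ 4) (hcop : Nat.Coprime (u * Y ^ 4) (v * Z ^ 4))
    (hsmall : ((a * u * v : ℕ) : ℝ) ≤ 260 * (D : ℝ) ^ (2 : ℕ)) (hDZ : D ≤ 2 * Z) (hD : 2 * (B + T) < D) :
    False := by
  have hTZ : T ≤ Z := by omega
  have hBZ : B < Z := by omega
  have hDZ' : (D : ℝ) ≤ 2 * (Z : ℝ) := by exact_mod_cast hDZ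
  have hD0 : (0 : ℝ) ≤ (D : ℝ) := by positivity
  have h1 : ((a * u * v : ℕ) : ℝ) ≤ (Z : ℝ) ^ η :=
    calc ((a * u * v : ℕ) : ℝ) ≤ 260 * (D : ℝ) ^ (2 : ℕ) := hsmall
      _ ≤ 260 * (2 * (Z : ℝ)) ^ (2 : ℕ) := by nlinarith
      _ = 1040 * (Z : ℝ) ^ (2 : ℕ) := by ring
      _ ≤ (Z : ℝ) ^ η := hT Z hTZ
  have := hB a u v Y Z ha hu hv hY hZ hsum hcop h1
  omega

/-- **Part (ii).** `UniformQuarticThue η` is false for every `η > 2`. [folklore] -/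
theorem not_quarticThue_of_two_lt (η : ℝ) (hη : 2 < η) :
    ¬ ∃ B : ℕ, ∀ a u v Y Z : ℕ, 0 < a → 0 < u → 0 < v → 0 < Y → 0 < Z →
      a + u * Y ^ 4 = v * Z ^ 4 → Nat.Coprime (u * Y ^ 4) (v * Z ^ 4) →
      ((a * u * v : ℕ) : ℝ) ≤ (Z : ℝ) ^ η → Z ≤ B := by
  rintro ⟨B, hB⟩
  obtain ⟨T, hT⟩ := exists_threshold_two_lt hη
  obtain ⟨α, hαdef⟩ : ∃ α : ℝ, α = Real.sqrt (Real.sqrt 2) := ⟨_, rfl⟩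
  have hα0 : 0 ≤ α := by rw [hαdef]; exact Real.sqrt_nonneg _
  have hα2 : α ^ 2 = Real.sqrt 2 := by rw [hαdef]; exact Real.sq_sqrt (Real.sqrt_nonneg _)
  have hα4 : α ^ 4 = 2 := by
    calc α ^ 4 = (α ^ 2) ^ 2 := by ring
      _ = 2 := by rw [hα2]; exact Real.sq_sqrt (by norm_num)
  have hαirr : Irrational α := by
    have h : Irrational (α ^ 2) := by rw [hα2]; exact irrational_sqrt_two
    exact Irrational.of_pow 2 h
  have hαlo : 7 / 6 < α := by
    refine lt_of_not_ge fun h => ?_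
    have : α ^ 4 ≤ (7 / 6 : ℝ) ^ 4 := pow_le_pow_left₀ hα0 h 4
    rw [hα4] at this; norm_num at this
  have hαhi : α < 6 / 5 := by
    refine lt_of_not_ge fun h => ?_
    have : (6 / 5 : ℝ) ^ 4 ≤ α ^ 4 := pow_le_pow_left₀ (by norm_num) h 4
    rw [hα4] at this; norm_num at this
  obtain ⟨q, hq, hqden⟩ := exists_rat_approx_den_gt hαirr (2 * (B + T) + 4)
  obtain ⟨d, hd⟩ : ∃ d : ℕ, d = q.den := ⟨_, rfl⟩
  obtain ⟨p, hp⟩ : ∃ p : ℕ, p = q.num.natAbs := ⟨_, rfl⟩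
  rw [← hd] at hq hqden
  have hd4 : 4 ≤ d := by omega
  have hdpos : 0 < d := by omega
  have hqpos : 0 < q := by
    have h1 : |α - q| < 1 := by
      have h1d : (1 : ℝ) ≤ d := by exact_mod_cast hdpos
      have : 1 / (d : ℝ) ^ 2 ≤ 1 := by
        rw [div_le_one (by positivity)]; nlinarith
      linarith
    have h2 : (0 : ℝ) < q := by
      have := (abs_lt.mp h1).2
      linarith
    exact_mod_cast h2
  have hnum : (p : ℤ) = q.num := by
    rw [hp]; exact Int.natAbs_of_nonneg (Rat.num_pos.mpr hqpos).le
  have hqcast : (q : ℝ) = (p : ℝ) / d := by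
    rw [Rat.cast_def, ← hd, ← hnum, Int.cast_natCast]
  have happ : |α - (p : ℝ) / d| < 1 / (d : ℝ) ^ 2 := by rw [← hqcast]; exact hq
  have hcopd : Nat.Coprime p d := by rw [hp, hd]; exact q.reduced
  obtain ⟨hdp, _hp3, hbound⟩ := approx_fourthRootTwo_bounds hα4 hαlo hαhi hd4 happ
  have habs := abs_le.mp hbound
  have hDbig : 2 * (B + T) < d := by omega
  rcases Nat.even_or_odd p with heven | hodd
  · -- `p = 2p'`, `d` odd
    obtain ⟨p', hp'⟩ := heven
    have hp2 : p = 2 * p' := by omega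
    have hp'0 : 0 < p' := by omega
    have hdodd : Odd d :=
      Nat.coprime_two_left.mp (Nat.Coprime.coprime_dvd_left ⟨p', hp2⟩ hcopd)
    have hd2 : Nat.Coprime d 2 := (Nat.coprime_two_left.mpr hdodd).symm
    have hd8 : Nat.Coprime d 8 := by
      have := Nat.Coprime.pow_right 3 hd2
      simpa using this
    have hdp' : Nat.Coprime d p' := Nat.Coprime.coprime_dvd_right ⟨2, by omega⟩ hcopd.symm
    have hcop1 : Nat.Coprime (d ^ 4) (8 * p' ^ 4) :=
      Nat.Coprime.mul_right (Nat.Coprime.pow_left 4 hd8) (Nat.Coprime.pow 4 4 hdp')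
    have hne : 8 * p' ^ 4 ≠ d ^ 4 := by
      intro h
      have h1 : Even (8 * p' ^ 4) := ⟨4 * p' ^ 4, by ring⟩
      have h2 : Odd (d ^ 4) := hdodd.pow
      rw [h] at h1
      exact (Nat.not_even_iff_odd.mpr h2) h1
    have hreal : ((p : ℝ) ^ 4 - 2 * (d : ℝ) ^ 4) = 2 * (8 * (p' : ℝ) ^ 4 - (d : ℝ) ^ 4) := by
      have : (p : ℝ) = 2 * p' := by exact_mod_cast hp2
      rw [this]; ring
    rcases lt_or_gt_of_ne hne with hlt | hgt
    · -- `8p'⁴ < d⁴`: `(d⁴ − 8p'⁴) + 8·p'⁴ = 1·d⁴`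
      have hsmall : (((d ^ 4 - 8 * p' ^ 4) * 8 * 1 : ℕ) : ℝ) ≤ 260 * (d : ℝ) ^ (2 : ℕ) := by
        rw [mul_one, Nat.cast_mul, Nat.cast_sub hlt.le]; push_cast; linarith [habs.1, habs.2, hreal]
      exact quarticThue_solution_contra hT hB (a := d ^ 4 - 8 * p' ^ 4) (u := 8) (Y := p') (v := 1)
        (Z := d) (D := d) (Nat.sub_pos_of_lt hlt) (by norm_num) (by norm_num) hp'0 hdpos
        (by rw [one_mul]; exact Nat.sub_add_cancel hlt.le) (by rw [one_mul]; exact hcop1.symm)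
        hsmall (by omega) hDbig
    · -- `d⁴ < 8p'⁴`: `(8p'⁴ − d⁴) + 1·d⁴ = 8·p'⁴`
      have hsmall : (((8 * p' ^ 4 - d ^ 4) * 1 * 8 : ℕ) : ℝ) ≤ 260 * (d : ℝ) ^ (2 : ℕ) := by
        rw [mul_one, Nat.cast_mul, Nat.cast_sub hgt.le]; push_cast; linarith [habs.1, habs.2, hreal]
      exact quarticThue_solution_contra hT hB (a := 8 * p' ^ 4 - d ^ 4) (u := 1) (Y := d) (v := 8)
        (Z := p') (D := d) (Nat.sub_pos_of_lt hgt) (by norm_num) (by norm_num) hdpos hp'0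
        (by rw [one_mul]; exact Nat.sub_add_cancel hgt.le) (by rw [one_mul]; exact hcop1)
        hsmall (by omega) hDbig
  · -- `p` odd
    have hcop1 : Nat.Coprime (2 * d ^ 4) (p ^ 4) :=
      Nat.Coprime.mul_left (Nat.coprime_two_left.mpr hodd.pow) (Nat.Coprime.pow 4 4 hcopd.symm)
    have hne : p ^ 4 ≠ 2 * d ^ 4 := by
      intro h
      have h1 : Odd (p ^ 4) := hodd.pow
      have h2 : Even (2 * d ^ 4) := ⟨d ^ 4, by ring⟩
      rw [h] at h1
      exact (Nat.not_even_iff_odd.mpr h1) h2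
    rcases lt_or_gt_of_ne hne with hlt | hgt
    · -- `p⁴ < 2d⁴`: `(2d⁴ − p⁴) + 1·p⁴ = 2·d⁴`
      have hsmall : (((2 * d ^ 4 - p ^ 4) * 1 * 2 : ℕ) : ℝ) ≤ 260 * (d : ℝ) ^ (2 : ℕ) := by
        rw [mul_one, Nat.cast_mul, Nat.cast_sub hlt.le]; push_cast; nlinarith [habs.1, habs.2]
      exact quarticThue_solution_contra hT hB (a := 2 * d ^ 4 - p ^ 4) (u := 1) (Y := p) (v := 2)
        (Z := d) (D := d) (Nat.sub_pos_of_lt hlt) (by norm_num) (by norm_num) (by omega) hdpos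
        (by rw [one_mul]; exact Nat.sub_add_cancel hlt.le) (by rw [one_mul]; exact hcop1.symm)
        hsmall (by omega) hDbig
    · -- `2d⁴ < p⁴`: `(p⁴ − 2d⁴) + 2·d⁴ = 1·p⁴`
      have hsmall : (((p ^ 4 - 2 * d ^ 4) * 2 * 1 : ℕ) : ℝ) ≤ 260 * (d : ℝ) ^ (2 : ℕ) := by
        rw [mul_one, Nat.cast_mul, Nat.cast_sub hgt.le]; push_cast; nlinarith [habs.1, habs.2]
      exact quarticThue_solution_contra hT hB (a := p ^ 4 - 2 * d ^ 4) (u := 2) (Y := d) (v := 1)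
        (Z := p) (D := d) (Nat.sub_pos_of_lt hgt) (by norm_num) (by norm_num) hdpos (by omega)
        (by rw [one_mul]; exact Nat.sub_add_cancel hgt.le) (by rw [one_mul]; exact hcop1)
        hsmall (by omega) hDbig

/-- **Stub `stub_quarticThueWindow` (certificate Stub 18, lead c22) of line `Sketch`, crux `DepthCountedABC`
(stmt-ABC-14938):** the window of the cell-0 sub-crux `UniformQuarticThue η` — implied by `ABC` for every
`0 < η < 8/5`, false for every `η > 2`. [folklore reduction] -/
theorem stub_quarticThueWindow :
    (_root_.ABC → ∀ η : ℝ, 0 < η → η < 8 / 5 →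
      ∃ B : ℕ, ∀ a u v Y Z : ℕ, 0 < a → 0 < u → 0 < v → 0 < Y → 0 < Z →
        a + u * Y ^ 4 = v * Z ^ 4 → Nat.Coprime (u * Y ^ 4) (v * Z ^ 4) →
        ((a * u * v : ℕ) : ℝ) ≤ (Z : ℝ) ^ η → Z ≤ B) ∧
    (∀ η : ℝ, 2 < η →
      ¬ ∃ B : ℕ, ∀ a u v Y Z : ℕ, 0 < a → 0 < u → 0 < v → 0 < Y → 0 < Z →
        a + u * Y ^ 4 = v * Z ^ 4 → Nat.Coprime (u * Y ^ 4) (v * Z ^ 4) →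
        ((a * u * v : ℕ) : ℝ) ≤ (Z : ℝ) ^ η → Z ≤ B) :=
  ⟨quarticThue_of_abc, not_quarticThue_of_two_lt⟩

end Summit.ABC.ABC.Theorems.DepthCountedABC
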